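import Summits.ResolutionOfSingularities.ResolutionOfSingularities.Theorems.HomologicalConductorNoZenoCaptureStep
import Summits.ResolutionOfSingularities.ResolutionOfSingularities.Theorems.HomologicalConductorNoZenoUnitOfRegularCentre
import Summits.ResolutionOfSingularities.ResolutionOfSingularities.Theorems.HomologicalConductorNoZenoDim2RegularCentre
import Summits.ResolutionOfSingularities.ResolutionOfSingularities.Theorems.SyzygyFlatteningRankOneTerminationR1OfNormal
import Literature.RingTheory.CohomologyAnnihilator.ModuleDescentFiniteSubextension
import Literature.AlgebraicGeometry.Resolution.DivisorialPlace
import Literature.AlgebraicGeometry.Resolution.ArithmeticalThreefolds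
import HarnessLib

/-!
# Crux `NoZeno` / `NoZenoR` (stmt-ResolutionOfSingularities-16483 / -19943), line `sandwich-cluster`:
# the EXIT DIVISOR of a singular step — towards the `≠` half of S4 `stub_basePtsStrictAnti`

Route `ResolutionOfSingularities/HomologicalConductor`.  OURS (cell res-hironaka); nothing here is a
statement of the manuscript under review.  Stub S4 (v10, lead res-L0-w44-lead-1) says: under
(Q_val at `m`) and with `T_(m+1)` singular, `basePts R T_(m+1) ⊂ basePts R T_m`.  The inclusion is
landed (`basePts_tower_succ_subset`, `…BasePtsCapture.lean`).  For strictness one needs an OLD base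
point that is NOT a base point of `T_(m+1)`; this file constructs the valuation that detects it —
the **exit divisor** `W` of the step `T = T_m ↦ T⁺ = T_(m+1)` (`m ≥ 1`), with NO use of (Q_val):

* `ca_le_iff_not_isRegularLocalRing_atPrime` — Iyengar–Takahashi 5.4 (a THEOREM of the tree,
  `singEqVCa_essFiniteType_holds`) at a prime of a stage: `ca(T_m) ≤ 𝔭 ↔ (T_m)_𝔭` singular.
* `isRegularLocalRing_atPrime_maximalIdeal_iff` — `R_𝔪 ≅ R` for a local ring (regularity form).
* `isMaximal_of_ca_le` — for a SINGULAR normal stage `T = T_(n+1)` (dimension `≤ 2`), a prime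
  containing `ca(T)` is maximal (`Sing T = V(ca T)` and `T` is `R₁`): `ca(T)` is `𝔪_T`-primary.
* `exists_admissible_of_not_isRegularLocalRing` — a singular normal stage has an admissible
  denominator `x ∈ ca(T)`, `x ≠ 0`, of minimal `O`-value.
* `exists_exitDivisor` — **the exit divisor.**  If `T⁺ = T_(n+2)` is singular then there is a
  valuation ring `W ≠ K` of `K` containing `k` and `T⁺`, essentially generated by `T⁺`
  (`w = a * s⁻¹`, `a, s ∈ T⁺`, `s` a `W`-unit), which DOMINATES `T = T_(n+1)` (an element of `T`
  inverted in `W` is inverted in `T`), does NOT dominate `T⁺` (some `t ∈ T⁺` is a unit of `W` but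
  not of `T⁺`), and is RESIDUALLY TRANSCENDENTAL over `k` (some `t ∈ W` has all its non-zero
  polynomial expressions over `k` units of `W`).  Construction: `T` is singular too (a regular stage
  is terminal), so `ca(T)` is a proper `𝔪_T`-primary ideal; with `x ∈ ca(T)` admissible,
  `ca(T) ⊆ x·T⁺` and `x ∈ 𝔪_(T⁺)`; a minimal prime `P` of `x·T⁺` has height one (Krull), so
  `W := (T⁺)_P` is a discrete valuation ring of `K` (`T⁺` is normal; `placeOfPrime`); `P ∩ T ⊇ ca(T)`
  forces `P ∩ T = 𝔪_T` (domination of `T`); `P ≠ 𝔪_(T⁺)` because `(T⁺)_P` is regular and `T⁺` is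
  not (no domination of `T⁺`); and `T⁺/P`, a domain over `k` which is not a field, has an element
  transcendental over `k` (residual transcendence).  In the language of the minimal resolution: `W`
  is an exceptional prime divisor of the normalised `ca`-blow-up through the centre of `O`, i.e. an
  `E_q` that stops being contracted — Lipman 1969 §12 («Rees valuations are essential»), here
  obtained without Rees valuations.

References: S. Iyengar, R. Takahashi, IMRN 2016, Thm 5.4 [`IyengarTakahashi2014`]; J. Lipman, Publ.
IHÉS 36 (1969) §12, §18 [`Lipman1969`]; O. Zariski, P. Samuel, Commutative Algebra II (1960) VI §14
Thm 33 [`ZariskiSamuel1960`]; H. Matsumura, Commutative Ring Theory (1987) Thm 11.5 [`Matsumura1987`].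
-/

noncomputable section

-- single-problem summit: the doubled namespace component `ResolutionOfSingularities` is forced
set_option linter.dupNamespace false

namespace Summit.ResolutionOfSingularities.ResolutionOfSingularities.Theorems.NoZeno.SandwichCluster

open Summit.ResolutionOfSingularities.ResolutionOfSingularities.Theses.HomologicalConductor
open Summit.ResolutionOfSingularities.ResolutionOfSingularities.Theorems.NoZeno.Birth
open Literature.AlgebraicGeometry.Resolution IsLocalRing Polynomial

variable {k K : Type} [Field k] [Field K] [Algebra k K]

/-! ## Iyengar–Takahashi 5.4 at a prime of a stage -/

/-- **`ca(T_m) ≤ 𝔭 ↔ (T_m)_𝔭` is singular**, for every prime `𝔭` of a stage `T_m` of the tower: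
Iyengar–Takahashi's Theorem 5.4 (`singEqVCa_essFiniteType_holds`, a theorem of the tree) applied to
`T_m`, which is a localisation of a finitely generated `k`-algebra (`tn_tower_invariant`).
[cite: IyengarTakahashi2014, Thm. 5.4] -/
theorem ca_le_iff_not_isRegularLocalRing_atPrime (O : ValuationSubring K) (A : Subalgebra k K)
    (hk : ∀ c : k, algebraMap k K c ∈ O) (hA : A.FG) (hfr : IsFractionRing ↥A K)
    (hAO : A.toSubring ≤ O.toSubring) (m : ℕ) (𝔭 : Ideal ↥(tower O A m)) [𝔭.IsPrime] :
    Literature.RingTheory.CohomologyAnnihilator.ca ↥(tower O A m) ≤ 𝔭 ↔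
      ¬ IsRegularLocalRing (Localization.AtPrime 𝔭) := by
  -- adapted from `stub_unitOfRegularCentre` (Theorems/HomologicalConductorNoZenoUnitOfRegularCentre.lean)
  obtain ⟨-, -, hET⟩ := tn_tower_invariant O A hk hA hfr hAO m
  haveI := hET
  obtain ⟨d, hd, -⟩ := exists_ringKrullDim_eq_and_trdeg_eq k
    ↥(Algebra.EssFiniteType.subalgebra k ↥(tower O A m))
  exact (Literature.RingTheory.CohomologyAnnihilator.singEqVCa_essFiniteType_holds.{0} k
    ↥(Algebra.EssFiniteType.subalgebra k ↥(tower O A m)) inferInstance d hd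
    (Algebra.EssFiniteType.submonoid k ↥(tower O A m)) ↥(tower O A m) inferInstance 𝔭).1

/-- For a local ring `T`, the localisation `T_𝔪` at the maximal ideal is regular iff `T` is
(`T ≅ T_𝔪`, `IsLocalization.atUnits`). [folklore] -/
theorem isRegularLocalRing_atPrime_maximalIdeal_iff (T : Type*) [CommRing T] [IsLocalRing T] :
    IsRegularLocalRing (Localization.AtPrime (maximalIdeal T)) ↔ IsRegularLocalRing T := by
  let e : T ≃ₐ[T] Localization.AtPrime (maximalIdeal T) :=
    IsLocalization.atUnits T (maximalIdeal T).primeCompl (fun x hx => by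
      by_contra h
      exact hx ((IsLocalRing.mem_maximalIdeal x).mpr (mem_nonunits_iff.mpr h)))
  exact ⟨fun _ => IsRegularLocalRing.of_ringEquiv e.symm.toRingEquiv,
    fun _ => IsRegularLocalRing.of_ringEquiv e.toRingEquiv⟩

/-! ## Stages are local; a singular normal stage has `𝔪`-primary `ca` -/

/-- **`ca` of a singular normal stage is `𝔪`-primary**: if the stage `T = T_(n+1)` (normal, of
dimension `≤ tr.deg_k K = 2`) is NOT regular, then every prime `𝔮 ⊇ ca(T)` is maximal.  Indeed a
non-maximal prime of the normal two-dimensional `T` has regular localisation (`R₁`,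
`SyzygyFlattening.stub_R1_of_normal`), which contradicts `ca(T) ≤ 𝔮` by Theorem 5.4.
[cite: IyengarTakahashi2014, Thm. 5.4; Matsumura1987, Thm. 11.5] -/
theorem isMaximal_of_ca_le (O : ValuationSubring K) (A : Subalgebra k K)
    (hk : ∀ c : k, algebraMap k K c ∈ O) (hA : A.FG) (hfr : IsFractionRing ↥A K)
    (hAO : A.toSubring ≤ O.toSubring) (htr : Algebra.trdeg k K = 2) (n : ℕ)
    (𝔮 : Ideal ↥(tower O A (n + 1))) [𝔮.IsPrime]
    (h : Literature.RingTheory.CohomologyAnnihilator.ca ↥(tower O A (n + 1)) ≤ 𝔮) : 𝔮.IsMaximal := by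
  haveI := hfr
  haveI : IsNoetherianRing ↥(tower O A (n + 1)) := stub_towerNoetherian k K O A hk hA hfr hAO _
  haveI : IsIntegrallyClosed ↥(tower O A (n + 1)) :=
    d2rc_isIntegrallyClosed_tower_succ O A hk hA hfr hAO n
  have hdim : ringKrullDim ↥(tower O A (n + 1)) ≤ (2 : ℕ) :=
    d2rc_ringKrullDim_tower_le O A (n + 1) htr.le
  by_contra hmax
  have hreg : IsRegularLocalRing (Localization.AtPrime 𝔮) :=
    SyzygyFlattening.stub_R1_of_normal ↥(tower O A (n + 1)) (by exact_mod_cast hdim) ⟨𝔮, ‹_›⟩ hmax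
  exact (ca_le_iff_not_isRegularLocalRing_atPrime O A hk hA hfr hAO (n + 1) 𝔮).mp h hreg

/-- For a SINGULAR stage `T_m`, `ca(T_m) ≤ 𝔪_(T_m)` (Theorem 5.4 at the maximal ideal, and
`T_𝔪 ≅ T`). [cite: IyengarTakahashi2014, Thm. 5.4] -/
theorem ca_le_maximalIdeal_of_not_isRegularLocalRing (O : ValuationSubring K) (A : Subalgebra k K)
    (hk : ∀ c : k, algebraMap k K c ∈ O) (hA : A.FG) (hfr : IsFractionRing ↥A K)
    (hAO : A.toSubring ≤ O.toSubring) (m : ℕ) [IsLocalRing ↥(tower O A m)]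
    (hsing : ¬ IsRegularLocalRing ↥(tower O A m)) :
    Literature.RingTheory.CohomologyAnnihilator.ca ↥(tower O A m) ≤ maximalIdeal ↥(tower O A m) := by
  rw [ca_le_iff_not_isRegularLocalRing_atPrime O A hk hA hfr hAO m,
    isRegularLocalRing_atPrime_maximalIdeal_iff]
  exact hsing

/-- **An admissible denominator exists at a singular normal stage**: some `x ∈ ca(T_(n+1))`,
`x ≠ 0`, has minimal `O`-value on `ca(T_(n+1))`.  (`ca ≠ 0`: the zero ideal of the singular `T`
is not maximal — `T` is not a field, fields being regular — hence does not contain `ca`;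
then `di_exists_admissible`.) [cite: IyengarTakahashi2014, Thm. 5.4] -/
theorem exists_admissible_of_not_isRegularLocalRing (O : ValuationSubring K) (A : Subalgebra k K)
    (hk : ∀ c : k, algebraMap k K c ∈ O) (hA : A.FG) (hfr : IsFractionRing ↥A K)
    (hAO : A.toSubring ≤ O.toSubring) (htr : Algebra.trdeg k K = 2) (n : ℕ)
    (hsing : ¬ IsRegularLocalRing ↥(tower O A (n + 1))) :
    ∃ x ∈ ca (tower O A (n + 1)), x ≠ 0 ∧ ∀ c ∈ ca (tower O A (n + 1)), c * x⁻¹ ∈ O := by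
  haveI : IsNoetherianRing ↥(tower O A (n + 1)) := stub_towerNoetherian k K O A hk hA hfr hAO _
  -- `ca(T) ≠ 0`: else `⊥ ⊇ ca(T)` would be maximal, `T` a field, hence regular
  have hne : ¬ Literature.RingTheory.CohomologyAnnihilator.ca ↥(tower O A (n + 1)) ≤ ⊥ := by
    intro hle
    have hmax : (⊥ : Ideal ↥(tower O A (n + 1))).IsMaximal :=
      isMaximal_of_ca_le O A hk hA hfr hAO htr n ⊥ hle
    haveI : IsLocalRing ↥(tower O A (n + 1)) := by
      obtain ⟨B, hBO, hTB⟩ := exists_tower_eq_loc O A hk hAO (n + 1)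
      rw [hTB, loc_eq_locAt]; exact SyzygyFlattening.isLocalRing_locAt O B hBO
    have hF : IsField ↥(tower O A (n + 1)) :=
      (IsLocalRing.isField_iff_maximalIdeal_eq).mpr (IsLocalRing.eq_maximalIdeal hmax).symm
    exact hsing (isRegularLocalRing_of_isField hF)
  obtain ⟨g, hg, hg0⟩ : ∃ g ∈ Literature.RingTheory.CohomologyAnnihilator.ca ↥(tower O A (n + 1)),
      g ≠ 0 := by
    by_contra! hcon
    exact hne fun g hg => by rw [hcon g hg]; exact Submodule.zero_mem _
  rw [Literature.RingTheory.CohomologyAnnihilator.ca_eq_cohomologyAnnihilator] at hg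
  have hgK : (g : K) ∈ ca (tower O A (n + 1)) := (tn_coe_mem_ca_iff _ g).mpr hg
  have hg0K : (g : K) ≠ 0 := fun h => hg0 (Subtype.ext h)
  exact di_exists_admissible O (tower O A (n + 1))
    (fun b hb => mem_valuationSubring_of_mem_tower O hk hAO (n + 1) b hb) hgK hg0K

/-! ## The exit divisor -/

/-- In a `k`-subalgebra of a field, a unit's inverse (in `K`) lies in the subalgebra. [folklore] -/
theorem inv_mem_of_isUnit {S : Subalgebra k K} {s : ↥S} (hs : IsUnit s) : (s : K)⁻¹ ∈ S := by
  by_cases hs0 : (s : K) = 0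
  · rw [hs0, inv_zero]; exact S.zero_mem
  obtain ⟨t, ht⟩ := hs.exists_left_inv
  have htK : (t : K) * (s : K) = 1 := by
    have := congrArg Subtype.val ht
    simpa using this
  rw [inv_eq_of_mul_eq_one_left htK]
  exact t.2

/-- In a `k`-subalgebra of a field, an element whose inverse lies in the subalgebra is a unit.
[folklore] -/
theorem isUnit_of_inv_mem {S : Subalgebra k K} {s : ↥S} (hs0 : (s : K) ≠ 0)
    (hs : (s : K)⁻¹ ∈ S) : IsUnit s :=
  IsUnit.of_mul_eq_one ⟨(s : K)⁻¹, hs⟩ (Subtype.ext (by simp [mul_inv_cancel₀ hs0]))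

/-- **Residual transcendence from a non-maximal centre.**  If a valuation ring `W ⊇ B` of `K`
has centre a NON-maximal prime `P` on the `k`-subalgebra `B` (an element of `B` is a non-unit of
`W` iff it lies in `P`), then some `t ∈ W` is residually transcendental over `k`: all its non-zero
polynomial expressions over `k` are units of `W`.  Indeed `B/P` is a domain over `k` which is not a
field, hence not algebraic over `k`; lift a transcendental element. [folklore] -/
theorem exists_residuallyTranscendental_of_not_isMaximal (B : Subalgebra k K) (P : Ideal ↥B)
    [P.IsPrime] (hP : ¬ P.IsMaximal) (W : ValuationSubring K) (hBW : B.toSubring ≤ W.toSubring)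
    (hnu : ∀ b : ↥B, (b : K) ∈ W.nonunits ↔ b ∈ P) :
    ∃ t ∈ W, ∀ p : k[X], p ≠ 0 → W.valuation (aeval t p) = 1 := by
  haveI : IsDomain (↥B ⧸ P) := Ideal.Quotient.isDomain P
  have hnotField : ¬ IsField (↥B ⧸ P) := fun hF =>
    hP ((Ideal.Quotient.maximal_ideal_iff_isField_quotient P).mpr hF)
  have hinj : Function.Injective (algebraMap k (↥B ⧸ P)) := (algebraMap k (↥B ⧸ P)).injective
  have hnotInt : ¬ Algebra.IsIntegral k (↥B ⧸ P) := by
    intro hI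
    exact hnotField ((Algebra.IsIntegral.isField_iff_isField hinj).mp (Semifield.toIsField k))
  rw [Algebra.isIntegral_iff, not_forall] at hnotInt
  obtain ⟨tbar, htbar⟩ := hnotInt
  obtain ⟨t, rfl⟩ := Ideal.Quotient.mk_surjective tbar
  refine ⟨(t : K), hBW (Subalgebra.mem_toSubring.mpr t.2), fun p hp => ?_⟩
  -- `p(t) ∉ P`, else `p(t̄) = 0` and `t̄` would be algebraic
  have hpt : aeval t p ∉ P := by
    intro hmem
    apply htbar
    have halg : IsAlgebraic k (Ideal.Quotient.mk P t) := by
      refine ⟨p, hp, ?_⟩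
      have h := Polynomial.aeval_algHom_apply (Ideal.Quotient.mkₐ k P) t p
      rw [Ideal.Quotient.mkₐ_eq_mk] at h
      rw [h]
      exact Ideal.Quotient.eq_zero_iff_mem.mpr hmem
    exact halg.isIntegral
  rw [Subalgebra.aeval_coe]
  have hnot : ((aeval t p : ↥B) : K) ∉ W.nonunits := fun h => hpt ((hnu _).mp h)
  have hmemW : ((aeval t p : ↥B) : K) ∈ W := hBW (Subalgebra.mem_toSubring.mpr (aeval t p).2)
  rw [ValuationSubring.mem_nonunits_iff] at hnot
  exact le_antisymm (W.valuation_le_one ⟨_, hmemW⟩) (not_lt.mp hnot)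

/-- **The exit divisor of a singular step.**  Let `T = T_(n+1)` and `T⁺ = T_(n+2)` be consecutive
(normal) stages of the canonical `ca`-tower with `T⁺` NOT regular (`tr.deg_k K = 2`).  Then there is
a valuation ring `W ≠ K` of `K`, containing `k` and `T⁺` and essentially generated by `T⁺`
(`w = a * s⁻¹` with `a, s ∈ T⁺`, `s⁻¹ ∈ W`), which dominates `T`, does not dominate `T⁺`, and is
residually transcendental over `k`.  (`W = (T⁺)_P` for a minimal prime `P` of `x·T⁺`, `x ∈ ca(T)`
admissible: an exceptional prime divisor of the normalised `ca`-blow-up of `T` through the centre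
of `O`.) [cite: Lipman1969, §12; IyengarTakahashi2014, Thm. 5.4; ZariskiSamuel1960, Ch. VI §14 Thm. 33] -/
theorem exists_exitDivisor (O : ValuationSubring K) (A : Subalgebra k K)
    (hk : ∀ c : k, algebraMap k K c ∈ O) (hA : A.FG) (hfr : IsFractionRing ↥A K)
    (hAO : A.toSubring ≤ O.toSubring) (htr : Algebra.trdeg k K = 2) (n : ℕ)
    (hsing : ¬ IsRegularLocalRing ↥(tower O A (n + 1 + 1))) :
    ∃ W : ValuationSubring K, W ≠ ⊤ ∧ (∀ c : k, algebraMap k K c ∈ W) ∧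
      (tower O A (n + 1 + 1)).toSubring ≤ W.toSubring ∧
      (∀ w ∈ W, ∃ a ∈ tower O A (n + 1 + 1), ∃ s ∈ tower O A (n + 1 + 1),
        s⁻¹ ∈ W ∧ w = a * s⁻¹) ∧
      (∀ t ∈ tower O A (n + 1), t⁻¹ ∈ W → t⁻¹ ∈ tower O A (n + 1)) ∧
      (∃ t ∈ tower O A (n + 1 + 1), t⁻¹ ∈ W ∧ t⁻¹ ∉ tower O A (n + 1 + 1)) ∧
      ∃ t ∈ W, ∀ p : k[X], p ≠ 0 → W.valuation (aeval t p) = 1 := by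
  haveI := hfr
  -- the two stages: noetherian, local; the upper one normal with `Frac = K`
  haveI : IsNoetherianRing ↥(tower O A (n + 1)) := stub_towerNoetherian k K O A hk hA hfr hAO _
  haveI : IsNoetherianRing ↥(tower O A (n + 1 + 1)) :=
    stub_towerNoetherian k K O A hk hA hfr hAO _
  haveI : IsLocalRing ↥(tower O A (n + 1)) := by
    obtain ⟨B, hBO, hTB⟩ := exists_tower_eq_loc O A hk hAO (n + 1)
    rw [hTB, loc_eq_locAt]; exact SyzygyFlattening.isLocalRing_locAt O B hBO
  haveI : IsLocalRing ↥(tower O A (n + 1 + 1)) := by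
    obtain ⟨B, hBO, hTB⟩ := exists_tower_eq_loc O A hk hAO (n + 1 + 1)
    rw [hTB, loc_eq_locAt]; exact SyzygyFlattening.isLocalRing_locAt O B hBO
  haveI : IsIntegrallyClosed ↥(tower O A (n + 1 + 1)) :=
    d2rc_isIntegrallyClosed_tower_succ O A hk hA hfr hAO (n + 1)
  haveI : IsFractionRing ↥(tower O A (n + 1 + 1)) K :=
    isFractionRing_subalgebra_of_le A _ (tn_tower_invariant O A hk hA hfr hAO (n + 1 + 1)).1
  have hTT : tower O A (n + 1) ≤ tower O A (n + 1 + 1) :=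
    fun t ht => d2rc_mem_tower_of_le O A (Nat.le_succ _) ht
  have hTO : ∀ t ∈ tower O A (n + 1 + 1), t ∈ O :=
    fun t ht => mem_valuationSubring_of_mem_tower O hk hAO _ t ht
  -- `T` is singular as well (a regular stage is terminal)
  have hsingT : ¬ IsRegularLocalRing ↥(tower O A (n + 1)) := by
    intro hreg
    apply hsing
    rw [tower_succ_eq_self_of_isRegularLocalRing O A hk hfr hAO (n + 1) hreg]
    exact hreg
  -- an admissible denominator `x ∈ ca(T)`; `ca(T) ⊆ x · T⁺`
  obtain ⟨x, hx, hx0, hmin⟩ :=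
    exists_admissible_of_not_isRegularLocalRing O A hk hA hfr hAO htr n hsingT
  have hxT : x ∈ tower O A (n + 1) := ca_subset _ hx
  have hxT' : x ∈ tower O A (n + 1 + 1) := hTT hxT
  have hcx : ∀ c ∈ ca (tower O A (n + 1)), c * x⁻¹ ∈ tower O A (n + 1 + 1) := by
    intro c hc
    rw [tower_succ]
    exact chart_le_loc_nrm_chart O _ (mul_inv_mem_chart O _ hc hx hx0 hmin)
  -- `x` is not a unit of `T`, hence `x⁻¹ ∉ O`, hence `x` is not a unit of `T⁺`
  have hxm : (⟨x, hxT⟩ : ↥(tower O A (n + 1))) ∈ maximalIdeal ↥(tower O A (n + 1)) := by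
    refine ca_le_maximalIdeal_of_not_isRegularLocalRing O A hk hA hfr hAO (n + 1) hsingT ?_
    rw [Literature.RingTheory.CohomologyAnnihilator.ca_eq_cohomologyAnnihilator]
    exact (tn_coe_mem_ca_iff _ ⟨x, hxT⟩).mp hx
  have hxO : x⁻¹ ∉ O := by
    intro h
    have hxinv : x⁻¹ ∈ tower O A (n + 1) :=
      (valuationSubring_dominates_tower O A hk hAO (n + 1) x hxT).2 h
    exact (IsLocalRing.mem_maximalIdeal _).mp hxm (isUnit_of_inv_mem hx0 hxinv)
  obtain ⟨x', hx'⟩ : ∃ x' : ↥(tower O A (n + 1 + 1)), (x' : K) = x := ⟨⟨x, hxT'⟩, rfl⟩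
  have hx'0 : x' ≠ 0 := fun h => hx0 (by rw [← hx', h]; rfl)
  have hx'm : x' ∈ maximalIdeal ↥(tower O A (n + 1 + 1)) := by
    rw [IsLocalRing.mem_maximalIdeal, mem_nonunits_iff]
    intro hu
    have h := inv_mem_of_isUnit hu
    rw [hx'] at h
    exact hxO (hTO _ h)
  -- a minimal prime `P` of `x · T⁺`: height one, inside `𝔪`
  obtain ⟨P, hPmin, -⟩ := Ideal.exists_minimalPrimes_le
    ((Ideal.span_singleton_le_iff_mem _).mpr hx'm)
  haveI hP : P.IsPrime := hPmin.1.1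
  have hxP : x' ∈ P := hPmin.1.2 (Ideal.mem_span_singleton_self x')
  have hPbot : P ≠ ⊥ := fun h => hx'0 (by rw [h, Ideal.mem_bot] at hxP; exact hxP)
  have hP1 : P.height = 1 := by
    refine le_antisymm (Ideal.height_le_one_of_isPrincipal_of_mem_minimalPrimes _ P hPmin) ?_
    rw [Order.one_le_iff_ne_zero]
    exact fun h => hPbot (Ideal.height_eq_zero_iff_eq_bot.mp h)
  -- the valuation ring `W = (T⁺)_P`
  haveI hdvr : IsDiscreteValuationRing (Localization.AtPrime P) :=
    isDiscreteValuationRing_localization_of_height_eq_one P hP1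
  let W : ValuationSubring K := placeOfPrime (tower O A (n + 1 + 1)) P inferInstance
  have hWnu : ∀ t : ↥(tower O A (n + 1 + 1)), (t : K) ∈ W.nonunits ↔ t ∈ P :=
    coe_mem_nonunits_placeOfPrime_iff (tower O A (n + 1 + 1)) P inferInstance
  have hTW : (tower O A (n + 1 + 1)).toSubring ≤ W.toSubring :=
    le_placeOfPrime (tower O A (n + 1 + 1)) P inferInstance
  -- units of `W` coming from `T⁺ ∖ P`
  have hunitW : ∀ t : ↥(tower O A (n + 1 + 1)), t ∉ P → (t : K)⁻¹ ∈ W := by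
    intro t ht
    have h := (not_congr (hWnu t)).mpr ht
    rw [ValuationSubring.mem_nonunits_iff_or, not_or, not_not] at h
    exact h.2
  -- `P ≠ 𝔪_(T⁺)`: `(T⁺)_P` is regular, `T⁺ ≅ (T⁺)_𝔪` is not
  have hPm : P ≠ maximalIdeal ↥(tower O A (n + 1 + 1)) := by
    intro hPeq
    have key : ∀ (Q : Ideal ↥(tower O A (n + 1 + 1))) [Q.IsPrime],
        Q = maximalIdeal ↥(tower O A (n + 1 + 1)) →
        IsRegularLocalRing (Localization.AtPrime Q) → IsRegularLocalRing ↥(tower O A (n + 1 + 1)) := by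
      rintro Q _ rfl h
      exact (isRegularLocalRing_atPrime_maximalIdeal_iff _).mp h
    haveI : IsPrincipalIdealRing (Localization.AtPrime P) := hdvr.toIsPrincipalIdealRing
    haveI : IsLocalRing (Localization.AtPrime P) := hdvr.toIsLocalRing
    haveI : IsDomain (Localization.AtPrime P) := inferInstance
    have hregP : IsRegularLocalRing (Localization.AtPrime P) := inferInstance
    exact hsing (key P hPeq hregP)
  -- `P ∩ T = 𝔪_T`: the contraction of `P` contains `ca(T)`, hence is maximal
  have hQ : ∀ t : ↥(tower O A (n + 1)), t ∈ maximalIdeal ↥(tower O A (n + 1)) →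
      Subalgebra.inclusion hTT t ∈ P := by
    set Q : Ideal ↥(tower O A (n + 1)) := P.comap (Subalgebra.inclusion hTT).toRingHom with hQdef
    haveI : Q.IsPrime := Ideal.comap_isPrime _ _
    have hcaQ : Literature.RingTheory.CohomologyAnnihilator.ca ↥(tower O A (n + 1)) ≤ Q := by
      intro g hg
      rw [Literature.RingTheory.CohomologyAnnihilator.ca_eq_cohomologyAnnihilator] at hg
      have hgK : (g : K) ∈ ca (tower O A (n + 1)) := (tn_coe_mem_ca_iff _ g).mpr hg
      have hgx : (g : K) * x⁻¹ ∈ tower O A (n + 1 + 1) := hcx _ hgK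
      rw [hQdef, Ideal.mem_comap]
      have : Subalgebra.inclusion hTT g = ⟨(g : K) * x⁻¹, hgx⟩ * x' := by
        apply Subtype.ext
        rw [Subalgebra.coe_inclusion, Subalgebra.coe_mul, hx', mul_assoc, inv_mul_cancel₀ hx0,
          mul_one]
      rw [show ((Subalgebra.inclusion hTT).toRingHom g) = Subalgebra.inclusion hTT g from rfl, this]
      exact Ideal.mul_mem_left _ _ hxP
    have hQmax : Q.IsMaximal := isMaximal_of_ca_le O A hk hA hfr hAO htr n Q hcaQ
    have hQeq : Q = maximalIdeal ↥(tower O A (n + 1)) := IsLocalRing.eq_maximalIdeal hQmax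
    intro t ht
    rw [← hQeq, hQdef, Ideal.mem_comap] at ht
    exact ht
  refine ⟨W, ?_, algebraMap_mem_placeOfPrime _ P inferInstance, hTW, ?_, ?_, ?_, ?_⟩
  · -- `W ≠ ⊤`: `x⁻¹ ∉ W`
    intro htop
    have h := (hWnu x').mpr hxP
    rw [ValuationSubring.mem_nonunits_iff_or, hx'] at h
    rcases h with h | h
    · exact hx0 h
    · exact h (htop ▸ ValuationSubring.mem_top _)
  · -- essential generation by `T⁺`
    intro w hw
    obtain ⟨b, s, hb, hs, hsu, hws⟩ :=
      exists_mul_eq_of_mem_placeOfPrime (tower O A (n + 1 + 1)) P inferInstance hw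
    have h := hsu
    rw [ValuationSubring.mem_nonunits_iff_or, not_or, not_not] at h
    refine ⟨b, hb, s, hs, h.2, ?_⟩
    rw [← hws, mul_assoc, mul_inv_cancel₀ h.1, mul_one]
  · -- `W` dominates `T`
    intro t ht htinv
    by_cases ht0 : t = 0
    · rw [ht0, inv_zero]; exact Subalgebra.zero_mem _
    have hnot : (t : K) ∉ W.nonunits := by
      rw [ValuationSubring.mem_nonunits_iff_or, not_or, not_not]
      exact ⟨ht0, htinv⟩
    have htP : Subalgebra.inclusion hTT ⟨t, ht⟩ ∉ P := fun h => hnot ((hWnu _).mpr h)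
    have htm : (⟨t, ht⟩ : ↥(tower O A (n + 1))) ∉ maximalIdeal ↥(tower O A (n + 1)) :=
      fun h => htP (hQ _ h)
    rw [IsLocalRing.mem_maximalIdeal, mem_nonunits_iff, not_not] at htm
    exact inv_mem_of_isUnit htm
  · -- `W` does not dominate `T⁺`: an element of `𝔪_(T⁺) ∖ P`
    have hlt : P < maximalIdeal ↥(tower O A (n + 1 + 1)) :=
      lt_of_le_of_ne (IsLocalRing.le_maximalIdeal hP.ne_top) hPm
    obtain ⟨t, htm, htP⟩ := SetLike.exists_of_lt hlt
    refine ⟨t, t.2, hunitW t htP, fun hinv => ?_⟩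
    have ht0 : (t : K) ≠ 0 := fun h => htP (by rw [show t = 0 from Subtype.ext h]; exact P.zero_mem)
    exact (IsLocalRing.mem_maximalIdeal _).mp htm (isUnit_of_inv_mem ht0 hinv)
  · -- residual transcendence: `T⁺/P` is a domain over `k` which is not a field
    have hPmax : ¬ P.IsMaximal := fun h => hPm (IsLocalRing.eq_maximalIdeal h)
    exact exists_residuallyTranscendental_of_not_isMaximal (tower O A (n + 1 + 1)) P hPmax W hTW
      hWnu

end Summit.ResolutionOfSingularities.ResolutionOfSingularities.Theorems.NoZeno.SandwichCluster

end
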